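import Summits.ResolutionOfSingularities.KangarooAtlas.MizutaniTriangular
import HarnessLib

/-!
# Hironaka's edge datum of `B_{P,𝔭}`: `dim B_{P,𝔭} = n + 1 − r`, exponent `= log_p q_r`, vector group `⟺ q = (1, …, 1)`

Cell `pub-rosobs`, Mizutani enclosure (seat mizutani-encloser-2, gen 5). AI-written; AI review is weaker than expert
review; NOT a resolution-of-singularities theorem (summit relevance C).

`MizutaniTriangular.lean` gave `U(𝔭) = k[σ_1, …, σ_r]` a TRIANGULAR basis (`σ_j = X_{ι(j)}^{p^{e_j}} + …`,
`e_1 ≤ … ≤ e_r`, tree `TriangularPresentation`) for every point `𝔭` of `ℙ^n_k`, with `U_+(𝔭)S = (σ)` and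
`(U(𝔭) ∩ L)_e = span_k {σ_j^{p^{e−e_j}} : e_j ≤ e}` on coefficient vectors (`hirForms_eq_span_coef_pow`).  Here the numbers of
Mizutani's §1 are read off the datum `(r; p^{e_1} ≤ … ≤ p^{e_r})` — Hironaka's edge datum of the homogeneous additive group
`B_{P,𝔭}` (tree `ridgeEdgeInv p (bIdeal k 𝔭)`, `= edgeInvK p (U(𝔭))` by `ridgeAlgebra_bIdeal_eq_multAlgebra`), the invariant
cell res-hironaka uses for ridges of tangent cones (Hironaka 2017 Eq. (34); CJS 2020 Rem. 18.29):

> **Mizutani 1973, §1 (c).** "When `Q = ΣQ_i` is a graded left `k[F]`-submodule of `L`, we can find an integer `e` such that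
> `Q_{i+1} = k·FQ_i (i ≥ e)` and `Q_e ≠ k·FQ_{e−1}`. We call such `e` the exponent of `Q` … We define the exponent of
> `B_{P,𝔭}` to be `e(U(𝔭) ∩ L)`."  **Rem. 1.2.** "`B` is a vector group if and only if the exponent of `B` equals `0`."
> **Thm. 1.3.** "`dim(Spec(S/N·S)) = dim_k(L_e/N_e)`."

PROVED (for a point `𝔭`, `P` any triangular presentation of `U(𝔭)`):
* `linearIndependent_frobVec_coef` — the Frobenius powers `c_j^{[p^{m_j}]}` of the echelon rows stay independent;
  **`finrank_hirForms_eq_card`** — `dim_k (U(𝔭) ∩ L)_e = #{j : e_j ≤ e}`;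
* **`hirForms_le_span_frobVec_image_of_forall_expo_le`** / **`coef_not_mem_span_frobVec_image`** — the exponent of the graded
  `k[F]`-module `U(𝔭) ∩ L` in Mizutani's sense is EXACTLY `max_j e_j` (generation from every level bounding all `e_j`; the
  row `c_j` is new at level `e_j`): `e(B_{P,𝔭}) = log_p q_r`;
* **`ringKrullDim_quotient_bIdeal_eq_sub_r`** — `dim B_{P,𝔭} := ringKrullDim (S ⧸ U_+(𝔭)S) = n + 1 − r` (with gen 4's Thm 1.3);
  `edgeInvK_multAlgebra_r`, `ridgeEdgeInv_bIdeal_eq`, **`ridgeDim_bIdeal_eq`**, **`ringKrullDim_quotient_bIdeal_eq_ridgeDim`** —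
  res-hironaka's reading of `dim B_{P,𝔭}` IS the dimension of the (ridge of the) group `B_{P,𝔭}` in Giraud's sense, `n + 1 − r`;
* **`isVectorGroup_iff_forall_expo_eq_zero`**, **`ridgeGeneratedInDegreeOne_iff_isVectorGroup`** — Rem. 1.2 in the edge datum:
  `B_{P,𝔭}` is a vector group iff all `q_j = 1`, i.e. iff its ridge "is generated in degree one" (tree
  `RidgeGeneratedInDegreeOne`, Frühbis-Krüger's indicator).  With `mizutani1973_vectorGroup_of_dim_le_holds` (gen 4):
  **`ridgeGeneratedInDegreeOne_of_dim_le`** — `dim B_{P,𝔭} ≤ 2p − 2 ⇒` the edge datum of `B_{P,𝔭}` is `(1, …, 1)`;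
* `pow_expo_le_ridgeTopDegree` / `ridgeTopDegree_le_pow` — the largest generator degree `ridgeTopDegree` of the datum is
  `p^{max_j e_j}` (for `r ≥ 1`), i.e. `p^{e(B_{P,𝔭})}`.
Sequel: `MizutaniEdgeDatumBound.lean` (with encloser-1 g4's `hirForms_eq_invForms`: `exponent k p 𝔭 = max_j e_j`, `hsDim = n + 1 − r`, and
Mizutani's theorem in the edge datum `2 · ridgeTopDegree ≤ ridgeDim + 1`).

## References

* H. Mizutani, *Hironaka's additive group schemes*, Nagoya Math. J. 52 (1973) 85–95, §1 (c), Rem. 1.2, Thm. 1.3, Thm. 2.8.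
  [Mizutani1973HironakaGroupSchemes]
* H. Hironaka, *Additive groups associated with points of a projective space*, Ann. of Math. 92 (1970), Th. 1. [Hironaka1970AdditiveGroups]
* J. Giraud, *Contact maximal en caractéristique positive*, Ann. Sci. ÉNS (4) 8 (1975), §1.6 (3), Lemme 1.7. [Giraud1975]
* V. Cossart, U. Jannsen, S. Saito, LNM 2270 (2020), Remark 18.29. [CossartJannsenSaito2020]
-/

noncomputable section

open MvPolynomial Literature.AlgebraicGeometry.Resolution Literature.AlgebraicGeometry.Resolution.HironakaScheme
open Literature.AlgebraicGeometry.Hironaka2017.EdgeAlgebra Literature.AlgebraicGeometry.Hironaka2017.Datum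

namespace Summit.ResolutionOfSingularities.KangarooAtlas.Mizutani

universe u

/-! ## 1. The echelon rows and their Frobenius powers are linearly independent -/

section Independent

variable (k : Type u) [Field k] (p : ℕ) [hp : Fact p.Prime] [CharP k p] {n : ℕ}
  {U : Subalgebra k (MvPolynomial (Fin (n + 1)) k)}

omit [CharP k p] in
/-- **Frobenius powers `c_j^{[p^{m_j}]}` of the rows of a triangular system are linearly independent** (any exponents
`m_j`): evaluate a relation at the pivot of the least index with nonzero coefficient — there the row has entry `1` and all
later rows have entry `0`. [cite: Giraud1975, §1.6 (3)] -/
theorem linearIndependent_frobVec_coef (P : TriangularPresentation p U) (m : Fin P.r → ℕ) :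
    LinearIndependent k (fun j : Fin P.r => frobVec k p (m j) (P.coef j)) := by
  classical
  rw [Fintype.linearIndependent_iff]
  intro g hg
  by_contra hne
  rw [not_forall] at hne
  obtain ⟨i₁, hi₁⟩ := hne
  set s : Finset (Fin P.r) := Finset.univ.filter fun i => g i ≠ 0 with hs_def
  have hs : s.Nonempty := ⟨i₁, by rw [hs_def, Finset.mem_filter]; exact ⟨Finset.mem_univ _, hi₁⟩⟩
  set i₀ := s.min' hs with hi₀_def
  have hmem : ∀ i, i ∈ s ↔ g i ≠ 0 := fun i => by
    rw [hs_def, Finset.mem_filter]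
    exact ⟨fun h => h.2, fun h => ⟨Finset.mem_univ _, h⟩⟩
  have hi₀ : g i₀ ≠ 0 := (hmem i₀).mp (Finset.min'_mem s hs)
  have hmin : ∀ i, g i ≠ 0 → i₀ ≤ i := fun i hi => Finset.min'_le s i ((hmem i).mpr hi)
  have h := congrFun hg (P.pivot i₀)
  rw [Finset.sum_apply, Pi.zero_apply] at h
  have hsum : (∑ i, (g i • frobVec k p (m i) (P.coef i)) (P.pivot i₀)) = g i₀ := by
    rw [Finset.sum_eq_single i₀]
    · rw [Pi.smul_apply, smul_eq_mul, frobVec, P.coef_pivot, one_pow, mul_one]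
    · intro i _ hi
      by_cases hgi : g i = 0
      · rw [Pi.smul_apply, hgi, zero_smul]
      · have hlt : i₀ < i := lt_of_le_of_ne (hmin i hgi) (Ne.symm hi)
        rw [Pi.smul_apply, smul_eq_mul, frobVec, P.coef_pivot_eq_zero i i₀ hlt, zero_pow (pow_ne_zero _ hp.out.ne_zero),
          mul_zero]
    · intro h
      exact absurd (Finset.mem_univ i₀) h
  rw [hsum] at h
  exact hi₀ h

end Independent

/-! ## 2. `dim_k (U(𝔭) ∩ L)_e = #{j : e_j ≤ e}` and the exponent of `U(𝔭) ∩ L` -/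

section Levels

variable (k : Type u) [Field k] (p : ℕ) [hp : Fact p.Prime] [CharP k p] {n : ℕ}
  (𝔭 : Ideal (MvPolynomial (Fin (n + 1)) k))

/-- **`dim_k (U(𝔭) ∩ L)_e = #{j : e_j ≤ e}`.** [cite: Mizutani1973HironakaGroupSchemes, Thm. 1.3 ("dim_k(L_e/N_e)")] -/
theorem finrank_hirForms_eq_card [𝔭.IsPrime] (P : TriangularPresentation p (multAlgebra k 𝔭)) (e : ℕ) :
    Module.finrank k (hirForms k p 𝔭 e) = Fintype.card {j : Fin P.r // P.expo j ≤ e} := by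
  classical
  have hli : LinearIndependent k (fun j : {j : Fin P.r // P.expo j ≤ e} => frobVec k p (e - P.expo j.1) (P.coef j.1)) :=
    (linearIndependent_frobVec_coef k p P fun j => e - P.expo j).comp _ Subtype.val_injective
  rw [hirForms_eq_span_coef_pow k p 𝔭 P e, Set.image_eq_range]
  exact finrank_span_eq_card hli

/-- **Generation from every level bounding all the `e_j`**: if `e_j ≤ E` for all `j`, then `(U ∩ L)_j = k·F^{j−E}(U ∩ L)_E` for
every `j ≥ E` — the exponent of `U(𝔭) ∩ L` is `≤ max_j e_j`. [cite: Mizutani1973HironakaGroupSchemes, §1 (c)] -/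
theorem hirForms_le_span_frobVec_image_of_forall_expo_le [𝔭.IsPrime] (P : TriangularPresentation p (multAlgebra k 𝔭))
    {E : ℕ} (hE : ∀ i : Fin P.r, P.expo i ≤ E) {j : ℕ} (hj : E ≤ j) :
    hirForms k p 𝔭 j ≤ Submodule.span k (frobVec k p (j - E) '' (hirForms k p 𝔭 E : Set (Fin (n + 1) → k))) := by
  rw [hirForms_eq_span_coef_pow k p 𝔭 P j]
  refine Submodule.span_le.mpr ?_
  rintro _ ⟨i, -, rfl⟩
  show frobVec k p (j - P.expo i) (P.coef i) ∈ _
  have heq : frobVec k p (j - P.expo i) (P.coef i) = frobVec k p (j - E) (frobVec k p (E - P.expo i) (P.coef i)) := by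
    rw [frobVec_frobVec]
    congr 1
    have := hE i
    omega
  rw [heq]
  refine Submodule.subset_span ⟨_, ?_, rfl⟩
  rw [SetLike.mem_coe, hirForms_eq_span_coef_pow k p 𝔭 P E]
  exact Submodule.subset_span ⟨i, hE i, rfl⟩

/-- **The row `c_j` is new at level `e_j`**: for `E < e_j`, `c_j ∈ (U ∩ L)_{e_j}` does not lie in `k·F^{e_j−E}(U ∩ L)_E` — the
exponent of `U(𝔭) ∩ L` is `≥ max_j e_j`. [cite: Mizutani1973HironakaGroupSchemes, §1 (c)] -/
theorem coef_not_mem_span_frobVec_image [𝔭.IsPrime] (P : TriangularPresentation p (multAlgebra k 𝔭)) (i : Fin P.r)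
    {E : ℕ} (hE : E < P.expo i) :
    P.coef i ∉ Submodule.span k (frobVec k p (P.expo i - E) '' (hirForms k p 𝔭 E : Set (Fin (n + 1) → k))) := by
  rw [hirForms_eq_span_coef_pow k p 𝔭 P E, span_image_frobVec_span, Set.image_image]
  have hset : (fun j : Fin P.r => frobVec k p (P.expo i - E) (frobVec k p (E - P.expo j) (P.coef j))) '' {j | P.expo j ≤ E} =
      (fun j : Fin P.r => frobVec k p (P.expo i - P.expo j) (P.coef j)) '' {j | P.expo j ≤ E} := by
    refine Set.image_congr fun j hj => ?_
    have hj' : P.expo j ≤ E := hj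
    rw [frobVec_frobVec]
    congr 1
    omega
  rw [hset]
  have hli := linearIndependent_frobVec_coef k p P fun j => P.expo i - P.expo j
  have hnot : i ∉ {j : Fin P.r | P.expo j ≤ E} := fun h => absurd (h : P.expo i ≤ E) (not_le.mpr hE)
  have h := hli.notMem_span_image hnot
  rwa [Nat.sub_self, frobVec_zero] at h

/-- The row `c_j` lies in `(U ∩ L)_{e_j}`. [folklore] -/
theorem coef_mem_hirForms [𝔭.IsPrime] (P : TriangularPresentation p (multAlgebra k 𝔭)) (i : Fin P.r) :
    P.coef i ∈ hirForms k p 𝔭 (P.expo i) := by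
  rw [hirForms_eq_span_coef_pow k p 𝔭 P (P.expo i)]
  have h : frobVec k p (P.expo i - P.expo i) (P.coef i) = P.coef i := by rw [Nat.sub_self, frobVec_zero]
  rw [← h]
  exact Submodule.subset_span ⟨i, (le_refl _ : P.expo i ≤ P.expo i), rfl⟩

/-- **At the level `e_j − 1` generation fails** (for `e_j ≥ 1`): `(U ∩ L)_{e_j} ≠ k·F(U ∩ L)_{e_j − 1}`.
[cite: Mizutani1973HironakaGroupSchemes, §1 (c) ("Q_e ≠ k·FQ_{e−1}")] -/
theorem not_hirForms_le_span_frobVec_image [𝔭.IsPrime] (P : TriangularPresentation p (multAlgebra k 𝔭)) (i : Fin P.r)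
    {E : ℕ} (hE : E < P.expo i) :
    ¬ hirForms k p 𝔭 (P.expo i) ≤
      Submodule.span k (frobVec k p (P.expo i - E) '' (hirForms k p 𝔭 E : Set (Fin (n + 1) → k))) :=
  fun h => coef_not_mem_span_frobVec_image k p 𝔭 P i hE (h (coef_mem_hirForms k p 𝔭 P i))

end Levels

/-! ## 3. `dim B_{P,𝔭} = n + 1 − r` and the edge datum -/

section Dimension

variable (k : Type u) [Field k] (p : ℕ) [hp : Fact p.Prime] [CharP k p] {n : ℕ}
  (𝔭 : Ideal (MvPolynomial (Fin (n + 1)) k))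

/-- **`dim B_{P,𝔭} = ringKrullDim (S ⧸ U_+(𝔭)S) = n + 1 − r`**, `r` the number of triangular generators of `U(𝔭)`.
[cite: Mizutani1973HironakaGroupSchemes, Thm. 1.3; CossartJannsenSaito2020, Remark 18.29] -/
theorem ringKrullDim_quotient_bIdeal_eq_sub_r [𝔭.IsPrime] (hP : IsPoint k 𝔭) (P : TriangularPresentation p (multAlgebra k 𝔭)) :
    ringKrullDim (MvPolynomial (Fin (n + 1)) k ⧸ bIdeal k 𝔭) = ((n + 1 - P.r : ℕ) : WithBot ℕ∞) := by
  classical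
  set E := Finset.univ.sup P.expo with hE_def
  have hE : ∀ i : Fin P.r, P.expo i ≤ E := fun i => Finset.le_sup (Finset.mem_univ i)
  have h := ringKrullDim_quotient_bIdeal_holds k p 𝔭 hP (e₀ := E)
    (fun j hj => hirForms_le_span_frobVec_image_of_forall_expo_le k p 𝔭 P hE hj)
  rw [h, finrank_hirForms_eq_card k p 𝔭 P E]
  congr 2
  rw [Fintype.card_subtype, Finset.filter_true_of_mem fun i _ => hE i, Finset.card_univ, Fintype.card_fin]

include hp in
/-- The edge datum of `U(𝔭)` has `r` entries (`r` of any triangular presentation). [folklore] -/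
theorem edgeInvK_multAlgebra_r [𝔭.IsPrime] (hP : IsPoint k 𝔭) (P : TriangularPresentation p (multAlgebra k 𝔭)) :
    haveI : ExpChar k p := ExpChar.prime hp.out
    (edgeInvK p (multAlgebra k 𝔭) (isGradedSubalgebra_multAlgebra k p 𝔭 hP) (isDiffStable_multAlgebra k p 𝔭 hP)).r = P.r := by
  rw [edgeInvK_eq_toEdgeInv _ _ P, EdgeInv.r]
  exact P.length_qList

/-- Transport of `edgeInvK` along an equality of subalgebras. [folklore] -/
theorem edgeInvK_congr {K : Type u} [Field K] {m q : ℕ} [ExpChar K q] {U U' : Subalgebra K (MvPolynomial (Fin m) K)}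
    (h : U = U') (hg : IsGradedSubalgebra U) (hd : IsDiffStable U) (hg' : IsGradedSubalgebra U') (hd' : IsDiffStable U') :
    edgeInvK q U hg hd = edgeInvK q U' hg' hd' := by
  subst h
  rfl

include hp in
/-- **Hironaka's edge datum of the group `B_{P,𝔭}` is the edge datum of `U(𝔭)`** (`U(𝔭)` is the invariant algebra of the ridge of
`B_{P,𝔭}`, `ridgeAlgebra_bIdeal_eq_multAlgebra`). [cite: Giraud1975, §1.6 (3)] -/
theorem ridgeEdgeInv_bIdeal_eq [𝔭.IsPrime] (hP : IsPoint k 𝔭) :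
    haveI : ExpChar k p := ExpChar.prime hp.out
    ridgeEdgeInv p (bIdeal k 𝔭) =
      edgeInvK p (multAlgebra k 𝔭) (isGradedSubalgebra_multAlgebra k p 𝔭 hP) (isDiffStable_multAlgebra k p 𝔭 hP) :=
  edgeInvK_congr (ridgeAlgebra_bIdeal_eq_multAlgebra k p 𝔭 hP) _ _ _ _

include hp in
/-- `(ridgeEdgeInv p (U_+(𝔭)S)).r = r`. [folklore] -/
theorem ridgeEdgeInv_bIdeal_r [𝔭.IsPrime] (hP : IsPoint k 𝔭) (P : TriangularPresentation p (multAlgebra k 𝔭)) :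
    haveI : ExpChar k p := ExpChar.prime hp.out
    (ridgeEdgeInv p (bIdeal k 𝔭)).r = P.r := by
  rw [ridgeEdgeInv_bIdeal_eq k p 𝔭 hP, edgeInvK_multAlgebra_r k p 𝔭 hP P]

include hp in
/-- **`dim Rid(B_{P,𝔭}) = n + 1 − r`** (tree `ridgeDim`: the dimension of the ridge of `B_{P,𝔭}`, which is `B_{P,𝔭}` itself).
[cite: CossartJannsenSaito2020, Remark 18.29] -/
theorem ridgeDim_bIdeal_eq [𝔭.IsPrime] (hP : IsPoint k 𝔭) (P : TriangularPresentation p (multAlgebra k 𝔭)) :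
    ridgeDim (bIdeal k 𝔭) = n + 1 - P.r := by
  haveI : ExpChar k p := ExpChar.prime hp.out
  rw [ridgeDim_eq_sub_ridgeEdgeInv_r p (bIdeal k 𝔭) (isHomogeneousIdeal_bIdeal k p 𝔭 hP), ridgeEdgeInv_bIdeal_r k p 𝔭 hP P]

include hp in
/-- **`ringKrullDim (S ⧸ U_+(𝔭)S) = ridgeDim (U_+(𝔭)S)`**: res-hironaka's reading of `dim B_{P,𝔭}` is the dimension of the
homogeneous additive group `B_{P,𝔭} = Rid(B_{P,𝔭})` in Giraud's sense. [cite: CossartJannsenSaito2020, Remark 18.29] -/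
theorem ringKrullDim_quotient_bIdeal_eq_ridgeDim [𝔭.IsPrime] (hP : IsPoint k 𝔭) :
    ringKrullDim (MvPolynomial (Fin (n + 1)) k ⧸ bIdeal k 𝔭) = (ridgeDim (bIdeal k 𝔭) : WithBot ℕ∞) := by
  obtain ⟨P⟩ := nonempty_triangularPresentation_multAlgebra k p 𝔭 hP
  rw [ringKrullDim_quotient_bIdeal_eq_sub_r k p 𝔭 hP P, ridgeDim_bIdeal_eq k p 𝔭 hP P]

end Dimension

/-! ## 4. Vector groups: all `q_j = 1` -/

section VectorGroup

variable (k : Type u) [Field k] (p : ℕ) [hp : Fact p.Prime] [CharP k p] {n : ℕ}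
  (𝔭 : Ideal (MvPolynomial (Fin (n + 1)) k))

/-- **Mizutani's Rem. 1.2 in the triangular basis: `B_{P,𝔭}` is a vector group iff every `e_j = 0`** (all generators linear).
[cite: Mizutani1973HironakaGroupSchemes, Rem. 1.2 (p. 86)] -/
theorem isVectorGroup_iff_forall_expo_eq_zero [𝔭.IsPrime] (hP : IsPoint k 𝔭) (P : TriangularPresentation p (multAlgebra k 𝔭)) :
    IsVectorGroup k 𝔭 ↔ ∀ j : Fin P.r, P.expo j = 0 := by
  classical
  constructor
  · intro hV j
    by_contra hj
    -- all levels have the dimension of level `0`; but `#{e_i ≤ E} = r > #{e_i ≤ 0}`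
    set E := Finset.univ.sup P.expo with hE_def
    have hE : ∀ i : Fin P.r, P.expo i ≤ E := fun i => Finset.le_sup (Finset.mem_univ i)
    have h := finrank_hirForms_eq_of_isVectorGroup_holds k p 𝔭 hP hV E
    rw [finrank_hirForms_eq_card k p 𝔭 P E, finrank_hirForms_eq_card k p 𝔭 P 0, Fintype.card_subtype, Fintype.card_subtype,
      Finset.filter_true_of_mem fun i _ => hE i] at h
    have hlt : (Finset.univ.filter fun i : Fin P.r => P.expo i ≤ 0).card < (Finset.univ : Finset (Fin P.r)).card :=
      Finset.card_lt_card (Finset.filter_ssubset.mpr ⟨j, Finset.mem_univ _, fun h0 => hj (Nat.le_zero.mp h0)⟩)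
    omega
  · intro h0
    -- every generator is a linear form
    have hlin : ∀ j : Fin P.r, P.gen j ∈ homogeneousSubmodule (Fin (n + 1)) k 1 := by
      intro j
      have h := P.isHomogeneous_gen j
      rw [TriangularPresentation.q, h0 j, pow_zero] at h
      exact h
    unfold IsVectorGroup
    refine le_antisymm ?_ (span_inter_one_le 𝔭)
    conv_lhs => rw [bIdeal_eq_span_range_gen k p 𝔭 P]
    refine Ideal.span_mono ?_
    rintro _ ⟨j, rfl⟩
    refine ⟨?_, hlin j⟩
    rw [SetLike.mem_coe, bIdeal_eq_span_range_gen k p 𝔭 P]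
    exact Ideal.subset_span ⟨j, rfl⟩

include hp in
/-- **`B_{P,𝔭}` is a vector group iff its edge datum is `(1, …, 1)`** ("ridge generated in degree one", tree
`RidgeGeneratedInDegreeOne`). [cite: Mizutani1973HironakaGroupSchemes, Rem. 1.2 (p. 86)] -/
theorem ridgeGeneratedInDegreeOne_iff_isVectorGroup [𝔭.IsPrime] (hP : IsPoint k 𝔭) :
    haveI : ExpChar k p := ExpChar.prime hp.out
    RidgeGeneratedInDegreeOne (ridgeEdgeInv p (bIdeal k 𝔭)) ↔ IsVectorGroup k 𝔭 := by
  haveI : ExpChar k p := ExpChar.prime hp.out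
  obtain ⟨P⟩ := nonempty_triangularPresentation_multAlgebra k p 𝔭 hP
  rw [isVectorGroup_iff_forall_expo_eq_zero k p 𝔭 hP P, ridgeEdgeInv_bIdeal_eq k p 𝔭 hP, edgeInvK_eq_toEdgeInv _ _ P,
    RidgeGeneratedInDegreeOne]
  show (∀ x ∈ P.qList, x = 1) ↔ _
  rw [TriangularPresentation.qList]
  simp only [List.mem_ofFn, TriangularPresentation.q]
  constructor
  · intro h j
    have hj := h (p ^ P.expo j) ⟨j, rfl⟩
    exact (Nat.pow_eq_one.mp hj).resolve_left hp.out.ne_one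
  · rintro h _ ⟨j, rfl⟩
    rw [h j, pow_zero]

include hp in
/-- **Mizutani 1973 Thm 2.8 in the edge datum: `dim B_{P,𝔭} ≤ 2p − 2 ⇒` the edge datum of `B_{P,𝔭}` is `(1, …, 1)`**
(via `mizutani1973_vectorGroup_of_dim_le_holds`, gen 4, i.e. the cell's `mizutaniLowerBound` at `e = 1`).
[cite: Mizutani1973HironakaGroupSchemes, Thm. 2.8 (p. 90) and p. 85 (1)] -/
theorem ridgeGeneratedInDegreeOne_of_dim_le [𝔭.IsPrime] (hP : IsPoint k 𝔭)
    (hdim : ringKrullDim (MvPolynomial (Fin (n + 1)) k ⧸ bIdeal k 𝔭) + 2 ≤ (2 * p : WithBot ℕ∞)) :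
    haveI : ExpChar k p := ExpChar.prime hp.out
    RidgeGeneratedInDegreeOne (ridgeEdgeInv p (bIdeal k 𝔭)) :=
  (ridgeGeneratedInDegreeOne_iff_isVectorGroup k p 𝔭 hP).mpr (mizutani1973_vectorGroup_of_dim_le_holds p k n 𝔭 hP hdim)

end VectorGroup

/-! ## 5. The exponent and Frühbis-Krüger's indicator `ridgeTopDegree` (largest generator degree) -/

section TopDegree

variable (k : Type u) [Field k] (p : ℕ) [hp : Fact p.Prime] [CharP k p] {n : ℕ}
  (𝔭 : Ideal (MvPolynomial (Fin (n + 1)) k))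

include hp in
/-- **Every `q_j = p^{e_j}` is at most the top generator degree of the edge datum of `B_{P,𝔭}`.**
[cite: Mizutani1973HironakaGroupSchemes, §1 (c)] -/
theorem pow_expo_le_ridgeTopDegree [𝔭.IsPrime] (hP : IsPoint k 𝔭) (P : TriangularPresentation p (multAlgebra k 𝔭))
    (j : Fin P.r) :
    haveI : ExpChar k p := ExpChar.prime hp.out
    p ^ P.expo j ≤ ridgeTopDegree (ridgeEdgeInv p (bIdeal k 𝔭)) := by
  haveI : ExpChar k p := ExpChar.prime hp.out
  -- members of a list are bounded by `foldr max 0` (cf. `ArithCircuit.le_foldr_max_of_mem`, inlined to keep imports local)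
  have key : ∀ (l : List ℕ) (x : ℕ), x ∈ l → x ≤ l.foldr max 0 := by
    intro l
    induction l with
    | nil => exact fun x h => absurd h List.not_mem_nil
    | cons a l ih =>
      intro x h
      rw [List.foldr_cons]
      rcases List.mem_cons.mp h with rfl | h'
      · exact le_max_left _ _
      · exact (ih x h').trans (le_max_right _ _)
  rw [ridgeEdgeInv_bIdeal_eq k p 𝔭 hP, edgeInvK_eq_toEdgeInv _ _ P, ridgeTopDegree]
  refine key _ _ ?_
  show p ^ P.expo j ∈ P.qList
  rw [TriangularPresentation.qList, List.mem_ofFn]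
  exact ⟨j, rfl⟩

include hp in
/-- **The top generator degree is at most `p^E` for every bound `E` of the `e_j`**; with `pow_expo_le_ridgeTopDegree`: for
`r ≥ 1` the indicator `ridgeTopDegree` of `B_{P,𝔭}` is `p^{max_j e_j} = p^{e(B_{P,𝔭})}`, Mizutani's exponent read through
`hirForms_le_span_frobVec_image_of_forall_expo_le` / `not_hirForms_le_span_frobVec_image`.
[cite: Mizutani1973HironakaGroupSchemes, §1 (c)] -/
theorem ridgeTopDegree_le_pow [𝔭.IsPrime] (hP : IsPoint k 𝔭) (P : TriangularPresentation p (multAlgebra k 𝔭))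
    {E : ℕ} (hE : ∀ j : Fin P.r, P.expo j ≤ E) :
    haveI : ExpChar k p := ExpChar.prime hp.out
    ridgeTopDegree (ridgeEdgeInv p (bIdeal k 𝔭)) ≤ p ^ E := by
  haveI : ExpChar k p := ExpChar.prime hp.out
  -- `foldr max 0` is bounded by any common bound (cf. `DepthReduction.foldr_max_le`, inlined to keep imports local)
  have key : ∀ (l : List ℕ) (b : ℕ), (∀ x ∈ l, x ≤ b) → l.foldr max 0 ≤ b := by
    intro l
    induction l with
    | nil => exact fun b _ => Nat.zero_le _
    | cons a l ih =>
      intro b h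
      rw [List.foldr_cons]
      exact max_le (h a List.mem_cons_self) (ih b fun x hx => h x (List.mem_cons_of_mem a hx))
  rw [ridgeEdgeInv_bIdeal_eq k p 𝔭 hP, edgeInvK_eq_toEdgeInv _ _ P, ridgeTopDegree]
  refine key _ _ fun x hx => ?_
  have hx' : x ∈ P.qList := hx
  rw [TriangularPresentation.qList, List.mem_ofFn] at hx'
  obtain ⟨j, rfl⟩ := hx'
  exact Nat.pow_le_pow_right hp.out.pos (hE j)

end TopDegree

end Summit.ResolutionOfSingularities.KangarooAtlas.Mizutani

end
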